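import Summits.BirchSwinnertonDyer.BirchSwinnertonDyer.Theorems.KolyvaginRoadThreeZhangSupplyPoitouTate
import HarnessLib

/-!
# Route `KolyvaginRoadThree`, deciding crux `ZhangSharpFrameAtThreeHL` (item stmt-BirchSwinnertonDyer-19574):
# (J) — the UNSIGNED JUMP at one place: relaxing a self-dual Selmer structure at a place `w` multiplies the Selmer
# group by EXACTLY `#H¹(K_w, M)^{1/2}`, so its image at `w` is not contained in a line
# (cell `bsd-stepL`, ACCEL seat `bsd-stepL-koly3b` g5; `--supports stmt-BirchSwinnertonDyer-19574`, helper; part XI of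
# the `KolyvaginRoadThreeZhangSupply*` series; the Poitou–Tate half of the binder `hjump` of part IX-b
# `supply_signed_of_jump_good`)

HONEST FRAMING. Theorems only; 0 definitions, 0 named facts, 0 `sorry`; CONDITIONAL on the three Poitou–Tate properties
`IsPerfect`, `SumLocalTermEqZero`, `SelmerComplement` of a family `inv` of local invariant maps (the content of the
named fact `poitouTate_selmerStructure_duality`) and on two NUMERIC SELF-DUALITY equalities; nothing about elliptic
curves or `p = 3` is asserted; closes nothing (T7). PARTITION: O2@3 (B10) × A1 × crux 19574 × the S2-ENGINE's
(Supply) binder — proves-glue.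

WHAT. Parts I–IV (`…ZhangSupplyMaximalIsotropy` … `…ZhangSupplyWeilCard`) gave McCallum's Prop. 2.1: the relaxed group
has a class with `loc_w ≠ 0` («jump ≥ 1»). The SIGNED supply of part IX-b needs «jump = 2»: the image at `w = λ` is not
inside a line. Here, for a finite `Γ_K`-module `M` killed by `n` and Selmer structures `𝓕 ≤ 𝓖` unramified outside
`S(T)` that DIFFER ONLY AT `w ∈ T`, STRICT resp. RELAXED there (`𝓕_w = 0`, `𝓖_w = H¹(K_w, M)`):
* §1 `card_selmerGroup_mul_eq_of_relax` — n1011's pair-counting form of Poitou–Tate (`card_selmerGroup_pair`, the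
  relative Greenberg–Wiles formula) specialised: `#H¹_𝓖 · #H¹_{𝓕*} = #H¹_𝓕 · #H¹_{𝓖*} · #H¹(K_w, M)`;
* §2 `relIndex_sq_eq_of_selfdual` — under the numeric self-duality `#H¹_{𝓕*}(K, M^D) = #H¹_𝓖(K, M)`,
  `#H¹_{𝓖*}(K, M^D) = #H¹_𝓕(K, M)` (for `M = E[n]`: Weil transport + LAGRANGIAN local conditions off `w` exchange the
  strict and relaxed structures with the duals): `[H¹_𝓖 : H¹_𝓕]² = #H¹(K_w, M)`;
* §3 `exists_forall_sub_zsmul_not_mem_ker` — finite group theory: if `[G : G ∩ ker f] > n` and `n` kills the target,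
  then for every `x₀` some `x ∈ G` has `f x ∉ ℤ · f x₀`;
* §4 `exists_forall_sub_zsmul_not_mem_ker_localization` — assembled: if `n² < #H¹(K_w, M)` then for every
  `x₀ ∈ H¹(K, M)` some `x ∈ H¹_𝓖(K, M)` has `x − a • x₀ ∉ ker loc_w` for all `a : ℤ` — the shape of the binder `hjump`
  (for `E[3]` at a Kolyvagin `λ`: `#H¹(K_λ, E[3]) = 81 > 9`).
What remains for `hjump` proper: the instantiation (genuine Kummer ∕ ordinary ∕ transverse conditions as a
`SelmerStructure` on `E[3]`, the dictionary with the global kernels, and the two self-duality counts from the Weil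
transport and the Lagrangian property) — the same local Tate-pairing package the S2-ENGINE already lists.

References: [cite: McCallumLMS1991, Prop. 2.1 (p. 296)] [cite: WZhang2014, Lemma 8.2] [cite: MilneADT2006, Ch. I,
Thm. 4.10] [cite: Howard2004HeegnerKolyvagin, Thm. 2.1.11] [cite: MazurRubin2004, Prop. 2.3.5] [cite:
DarmonDiamondTaylor1997, Thm. 2.19].
-/

noncomputable section

open scoped Classical NumberField
open Function NumberField IsDedekindDomain
open Literature.NumberTheory.GaloisRepresentations Literature.NumberTheory.GaloisRepresentations.DiscreteGaloisModule
  Literature.NumberTheory.GaloisCohomology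
open Summit.BirchSwinnertonDyer.Rank1Residual.X11b.FiniteDuality
open Summit.BirchSwinnertonDyer.Rank1Residual.GaloisImage

universe u

namespace Summit.BirchSwinnertonDyer.Rank1Residual.X11b.Three.Koly.ZhangSupply

variable {K : Type u} [Field K] [NumberField K] {n : ℕ}
variable {M : Type u} [AddCommGroup M] [TopologicalSpace M] [DiscreteTopology M] [Finite M]
variable {ρ : DiscreteGaloisModule K M} (T : Finset (HeightOneSpectrum (𝓞 K))) (inv : LocalInvariants K n)

/-! ## §1 The pair count for a relaxation at ONE place -/

/-- **Relaxing at one place: `#H¹_𝓖 · #H¹_{𝓕*} = #H¹_𝓕 · #H¹_{𝓖*} · #H¹(K_w, M)`.** `𝓕 ≤ 𝓖` unramified outside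
`S(T)`, equal at every place except `w ∈ T`, where `𝓕_w = 0` and `𝓖_w = H¹(K_w, M)`; `inv` a Poitou–Tate family.
(n1011's `card_selmerGroup_pair` with `∏_T #𝓖_v = #H¹(K_w, M) · ∏_{T∖w} #𝓕_v`.) [cite: MilneADT2006, Ch. I, Thm. 4.10]
[cite: MazurRubin2004, Prop. 2.3.5] -/
theorem card_selmerGroup_mul_eq_of_relax [NeZero n] (hperf : inv.IsPerfect) (hsum : inv.SumLocalTermEqZero)
    (hcompl : inv.SelmerComplement) (hM : ∀ m : M, n • m = 0)
    (hS : ∀ v : HeightOneSpectrum (𝓞 K), v ∉ T → ((n : ℕ) : 𝓞 K) ∉ v.asIdeal ∧ GaloisRep.IsUnramifiedAt v ρ)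
    {𝓕 𝓖 : SelmerStructure ρ} (h𝓕 : 𝓕.IsUnramifiedOutside (finSupport T))
    (h𝓖 : 𝓖.IsUnramifiedOutside (finSupport T)) (w : T)
    (heq : ∀ v : Place K, v ≠ Sum.inr w.1 → 𝓕 v = 𝓖 v)
    (hstrict : 𝓕 (Sum.inr w.1) = ⊥) (hrelax : 𝓖 (Sum.inr w.1) = ⊤) :
    Nat.card 𝓖.selmerGroup * Nat.card (inv.dualSelmerStructure ρ 𝓕).selmerGroup =
      Nat.card 𝓕.selmerGroup * Nat.card (inv.dualSelmerStructure ρ 𝓖).selmerGroup *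
        Nat.card (galoisCohomology (ρ.toLocal (Sum.inr w.1)) 1) := by
  haveI : ∀ v : HeightOneSpectrum (𝓞 K), Finite (galoisCohomology (ρ.toLocal (Sum.inr v)) 1) :=
    fun v ↦ finite_galoisCohomology_one_toLocal ρ v
  have hle : 𝓕 ≤ 𝓖 := fun v ↦ by
    by_cases hv : v = Sum.inr w.1
    · subst hv; rw [hstrict]; exact bot_le
    · exact (heq v hv).le
  have hinf : ∀ u : InfinitePlace K, 𝓕 (Sum.inl u) = 𝓖 (Sum.inl u) := fun u ↦ heq _ (by simp)
  have h := card_selmerGroup_pair ρ T inv hperf hsum hcompl hM hS hle h𝓕 h𝓖 hinf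
  -- split the two products at `w`
  have hw : w.1 ∈ T := w.2
  have hF : ∏ v ∈ T, Nat.card (𝓕 (Sum.inr v)) = ∏ v ∈ T.erase w.1, Nat.card (𝓕 (Sum.inr v)) := by
    rw [← Finset.mul_prod_erase T _ hw, hstrict, AddSubgroup.card_bot, one_mul]
  have hG : ∏ v ∈ T, Nat.card (𝓖 (Sum.inr v)) =
      Nat.card (galoisCohomology (ρ.toLocal (Sum.inr w.1)) 1) * ∏ v ∈ T.erase w.1, Nat.card (𝓕 (Sum.inr v)) := by
    rw [← Finset.mul_prod_erase T _ hw, hrelax, AddSubgroup.card_top]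
    congr 1
    refine Finset.prod_congr rfl fun v hv ↦ ?_
    rw [heq (Sum.inr v) (fun h' ↦ Finset.ne_of_mem_erase hv (Sum.inr_injective h'))]
  rw [hF, hG] at h
  have hpos : 0 < ∏ v ∈ T.erase w.1, Nat.card (𝓕 (Sum.inr v)) :=
    Finset.prod_pos fun v _ ↦ Nat.card_pos
  refine Nat.eq_of_mul_eq_mul_right hpos ?_
  calc Nat.card 𝓖.selmerGroup * Nat.card (inv.dualSelmerStructure ρ 𝓕).selmerGroup *
        ∏ v ∈ T.erase w.1, Nat.card (𝓕 (Sum.inr v))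
      = Nat.card 𝓕.selmerGroup * Nat.card (inv.dualSelmerStructure ρ 𝓖).selmerGroup *
          (Nat.card (galoisCohomology (ρ.toLocal (Sum.inr w.1)) 1) *
            ∏ v ∈ T.erase w.1, Nat.card (𝓕 (Sum.inr v))) := h
    _ = _ := by ring

/-! ## §2 Under numeric self-duality the index of the relaxation is EXACTLY `#H¹(K_w, M)^{1/2}` -/

/-- **`[H¹_𝓖 : H¹_𝓕]² = #H¹(K_w, M)`** in the situation of `card_selmerGroup_mul_eq_of_relax`, given the numeric
self-duality `#H¹_{𝓕*}(K, M^D) = #H¹_𝓖(K, M)` and `#H¹_{𝓖*}(K, M^D) = #H¹_𝓕(K, M)` (for `M ≅ M^D` self-dual with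
LAGRANGIAN conditions off `w`, the Weil transport identifies `H¹_{𝓕*}` with `H¹_𝓖` and `H¹_{𝓖*}` with `H¹_𝓕`). So the
relaxed group is `#H¹(K_w, M)^{1/2}` times the strict one — the image at `w` is a MAXIMAL isotropic subgroup, not merely
non-zero. [cite: McCallumLMS1991, Prop. 2.1 (p. 296)] [cite: MilneADT2006, Ch. I, Thm. 4.10] -/
theorem relIndex_sq_eq_of_selfdual [NeZero n] (hperf : inv.IsPerfect) (hsum : inv.SumLocalTermEqZero)
    (hcompl : inv.SelmerComplement) (hM : ∀ m : M, n • m = 0)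
    (hS : ∀ v : HeightOneSpectrum (𝓞 K), v ∉ T → ((n : ℕ) : 𝓞 K) ∉ v.asIdeal ∧ GaloisRep.IsUnramifiedAt v ρ)
    {𝓕 𝓖 : SelmerStructure ρ} (h𝓕 : 𝓕.IsUnramifiedOutside (finSupport T))
    (h𝓖 : 𝓖.IsUnramifiedOutside (finSupport T)) (w : T)
    (heq : ∀ v : Place K, v ≠ Sum.inr w.1 → 𝓕 v = 𝓖 v)
    (hstrict : 𝓕 (Sum.inr w.1) = ⊥) (hrelax : 𝓖 (Sum.inr w.1) = ⊤)
    (hfin : Finite 𝓕.selmerGroup)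
    (hFd : Nat.card (inv.dualSelmerStructure ρ 𝓕).selmerGroup = Nat.card 𝓖.selmerGroup)
    (hGd : Nat.card (inv.dualSelmerStructure ρ 𝓖).selmerGroup = Nat.card 𝓕.selmerGroup) :
    (𝓕.selmerGroup.relIndex 𝓖.selmerGroup) ^ 2 = Nat.card (galoisCohomology (ρ.toLocal (Sum.inr w.1)) 1) := by
  have hle : 𝓕.selmerGroup ≤ 𝓖.selmerGroup := fun x hx ↦ by
    rw [SelmerStructure.mem_selmerGroup_iff] at hx ⊢
    intro v
    by_cases hv : v = Sum.inr w.1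
    · subst hv; rw [hrelax]; trivial
    · rw [← heq v hv]; exact hx v
  have h := card_selmerGroup_mul_eq_of_relax T inv hperf hsum hcompl hM hS h𝓕 h𝓖 w heq hstrict hrelax
  rw [hFd, hGd] at h
  -- `#H¹_𝓕 · [H¹_𝓖 : H¹_𝓕] = #H¹_𝓖` (no finiteness of the ambient group needed)
  have hidx : Nat.card 𝓕.selmerGroup * 𝓕.selmerGroup.relIndex 𝓖.selmerGroup = Nat.card 𝓖.selmerGroup := by
    rw [← Nat.card_congr (AddSubgroup.addSubgroupOfEquivOfLe hle).toEquiv]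
    exact AddSubgroup.card_mul_index _
  have hpos : 0 < Nat.card 𝓕.selmerGroup * Nat.card 𝓕.selmerGroup := Nat.mul_pos Nat.card_pos Nat.card_pos
  refine Nat.eq_of_mul_eq_mul_left hpos ?_
  calc Nat.card 𝓕.selmerGroup * Nat.card 𝓕.selmerGroup * (𝓕.selmerGroup.relIndex 𝓖.selmerGroup) ^ 2
      = (Nat.card 𝓕.selmerGroup * 𝓕.selmerGroup.relIndex 𝓖.selmerGroup) *
          (Nat.card 𝓕.selmerGroup * 𝓕.selmerGroup.relIndex 𝓖.selmerGroup) := by ring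
    _ = Nat.card 𝓖.selmerGroup * Nat.card 𝓖.selmerGroup := by rw [hidx]
    _ = Nat.card 𝓕.selmerGroup * Nat.card 𝓕.selmerGroup *
          Nat.card (galoisCohomology (ρ.toLocal (Sum.inr w.1)) 1) := h

/-! ## §3 Finite group theory: an image of order `> n` in an `n`-torsion group is not inside a cyclic line -/

/-- **An image larger than `n` escapes every line.** `f : H → L` additive with `n · L = 0` (`n ≠ 0`), `G ≤ H` with
`[G : G ∩ ker f] > n`. Then for every `x₀ ∈ H` there is `x ∈ G` with `f x ≠ a • f x₀` for all `a : ℤ`, i.e.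
`x − a • x₀ ∉ ker f`: the multiples `ℤ · f x₀` number at most `n`, the image `f(G) ≅ G/(G ∩ ker f)` more. [folklore] -/
theorem exists_forall_sub_zsmul_not_mem_ker {H L : Type*} [AddCommGroup H] [AddCommGroup L] (f : H →+ L)
    (hn : n ≠ 0) (hL : ∀ y : L, n • y = 0) (G : AddSubgroup H) [Finite (G.map f)]
    (hG : n < Nat.card (G.map f)) (x₀ : H) :
    ∃ x ∈ G, ∀ a : ℤ, x - a • x₀ ∉ f.ker := by
  -- the line through `f x₀` inside the image, as the image of `Finset.range n`
  by_contra! hall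
  -- every element of `f(G)` is `a • f x₀` with `a < n`
  have hsub : ∀ y ∈ G.map f, y ∈ (Finset.range n).image (fun a : ℕ ↦ (a : ℤ) • f x₀) := by
    rintro y ⟨x, hx, rfl⟩
    obtain ⟨a, ha⟩ := hall x hx
    rw [AddMonoidHom.mem_ker, map_sub, map_zsmul, sub_eq_zero] at ha
    refine Finset.mem_image.mpr ⟨(a % n).toNat, Finset.mem_range.mpr ?_, ?_⟩
    · have h0 : (0 : ℤ) ≤ a % n := Int.emod_nonneg a (by exact_mod_cast hn)
      have h1 : a % n < n := Int.emod_lt_of_pos a (by exact_mod_cast Nat.pos_of_ne_zero hn)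
      omega
    · rw [ha]
      have h0 : (0 : ℤ) ≤ a % n := Int.emod_nonneg a (by exact_mod_cast hn)
      rw [Int.toNat_of_nonneg h0]
      have hper : ∀ z : L, ((n : ℤ)) • z = 0 := fun z ↦ by rw [natCast_zsmul]; exact hL z
      conv_rhs => rw [← Int.emod_add_mul_ediv a n]
      rw [add_zsmul, mul_zsmul, hper, add_zero]
  have hcard : Nat.card (G.map f) ≤ n := by
    have hfin : Set.Finite ((G.map f : Set L)) := Set.toFinite _
    calc Nat.card (G.map f) = Nat.card ((G.map f : Set L)) := rfl
      _ ≤ Nat.card (((Finset.range n).image (fun a : ℕ ↦ (a : ℤ) • f x₀) : Finset L) : Set L) :=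
          Nat.card_mono (Set.toFinite _) (fun y hy ↦ Finset.mem_coe.mpr (hsub y hy))
      _ = ((Finset.range n).image (fun a : ℕ ↦ (a : ℤ) • f x₀)).card := by
          rw [Nat.card_eq_card_toFinset, Finset.toFinset_coe]
      _ ≤ (Finset.range n).card := Finset.card_image_le
      _ = n := Finset.card_range n
  exact absurd hG (not_lt.mpr hcard)

/-! ## §4 (J) assembled: the image of the relaxed Selmer group at `w` is not inside a line -/

/-- **(J) — the image at `w` of the `w`-relaxed Selmer group of a numerically self-dual structure is not contained in a
line**, whenever `n² < #H¹(K_w, M)`: for every `x₀ ∈ H¹(K, M)` some `x ∈ H¹_𝓖(K, M)` satisfies `x − a • x₀ ∉ ker loc_w`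
for all `a : ℤ`. (`[H¹_𝓖 : H¹_𝓕]² = #H¹(K_w, M) > n²` by §2, `H¹_𝓕 = H¹_𝓖 ∩ ker loc_w`, and §3.) For `M = E[3]` at a
Kolyvagin prime `λ` (`#H¹(K_λ, E[3]) = 81`) with the level-`n` structure of the KOLY method line this is the binder
`hjump` of part IX-b, up to the dictionary genuine local conditions ↔ global kernels.
[cite: McCallumLMS1991, Prop. 2.1 (p. 296)] [cite: WZhang2014, Lemma 8.2] [cite: MilneADT2006, Ch. I, Thm. 4.10] -/
theorem exists_forall_sub_zsmul_not_mem_ker_localization [NeZero n] (hperf : inv.IsPerfect)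
    (hsum : inv.SumLocalTermEqZero) (hcompl : inv.SelmerComplement) (hM : ∀ m : M, n • m = 0)
    (hS : ∀ v : HeightOneSpectrum (𝓞 K), v ∉ T → ((n : ℕ) : 𝓞 K) ∉ v.asIdeal ∧ GaloisRep.IsUnramifiedAt v ρ)
    {𝓕 𝓖 : SelmerStructure ρ} (h𝓕 : 𝓕.IsUnramifiedOutside (finSupport T))
    (h𝓖 : 𝓖.IsUnramifiedOutside (finSupport T)) (w : T)
    (heq : ∀ v : Place K, v ≠ Sum.inr w.1 → 𝓕 v = 𝓖 v)
    (hstrict : 𝓕 (Sum.inr w.1) = ⊥) (hrelax : 𝓖 (Sum.inr w.1) = ⊤) (hfin : Finite 𝓕.selmerGroup)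
    (hFd : Nat.card (inv.dualSelmerStructure ρ 𝓕).selmerGroup = Nat.card 𝓖.selmerGroup)
    (hGd : Nat.card (inv.dualSelmerStructure ρ 𝓖).selmerGroup = Nat.card 𝓕.selmerGroup)
    (hw : n ^ 2 < Nat.card (galoisCohomology (ρ.toLocal (Sum.inr w.1)) 1)) (x₀ : galoisCohomology ρ 1) :
    ∃ x ∈ 𝓖.selmerGroup, ∀ a : ℤ,
      x - a • x₀ ∉ (galoisCohomology.localization ρ (Sum.inr w.1) 1).ker := by
  haveI : Finite (galoisCohomology (ρ.toLocal (Sum.inr w.1)) 1) := finite_galoisCohomology_one_toLocal ρ w.1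
  set f := galoisCohomology.localization ρ (Sum.inr w.1) 1 with hf
  -- `H¹_𝓕 = H¹_𝓖 ∩ ker loc_w`
  have hFG : 𝓕.selmerGroup = 𝓖.selmerGroup ⊓ f.ker := by
    ext x
    rw [AddSubgroup.mem_inf, SelmerStructure.mem_selmerGroup_iff, SelmerStructure.mem_selmerGroup_iff,
      AddMonoidHom.mem_ker]
    constructor
    · intro hx
      refine ⟨fun v ↦ ?_, ?_⟩
      · by_cases hv : v = Sum.inr w.1
        · subst hv; rw [hrelax]; trivial
        · rw [← heq v hv]; exact hx v
      · have h := hx (Sum.inr w.1)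
        rw [hstrict] at h
        exact (AddSubgroup.mem_bot).mp h
    · rintro ⟨hx, hx0⟩ v
      by_cases hv : v = Sum.inr w.1
      · subst hv; rw [hstrict]; exact (AddSubgroup.mem_bot).mpr hx0
      · rw [heq v hv]; exact hx v
  -- the index of the relaxation is `> n`
  have hsq := relIndex_sq_eq_of_selfdual T inv hperf hsum hcompl hM hS h𝓕 h𝓖 w heq hstrict hrelax hfin hFd hGd
  have hidx : n < 𝓕.selmerGroup.relIndex 𝓖.selmerGroup := by
    by_contra! hle
    have := Nat.pow_le_pow_left hle 2
    rw [hsq] at this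
    exact absurd hw (not_lt.mpr this)
  -- `#f(H¹_𝓖) = [H¹_𝓖 : H¹_𝓖 ∩ ker f]`
  have hcard : Nat.card (𝓖.selmerGroup.map f) = 𝓕.selmerGroup.relIndex 𝓖.selmerGroup := by
    rw [hFG, AddSubgroup.inf_relIndex_left, AddSubgroup.relIndex_ker]
  have hA : ∀ y : galoisCohomology (ρ.toLocal (Sum.inr w.1)) 1, n • y = 0 :=
    fun y ↦ nsmul_continuousCohomology_one_eq_zero _ n hM y
  exact exists_forall_sub_zsmul_not_mem_ker f (NeZero.ne n) hA 𝓖.selmerGroup (by rw [hcard]; exact hidx) x₀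

end Summit.BirchSwinnertonDyer.Rank1Residual.X11b.Three.Koly.ZhangSupply

end
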